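import Summits.QuantumFields.BalabanUV.Beta.GAN24.SymContactLambdaEntryBound
import Summits.QuantumFields.BalabanUV.Beta.GAN24.BornLambdaContactLineage
import Summits.QuantumFields.BalabanUV.Beta.GAN24.CombContactGaugeStaircase
import Summits.QuantumFields.BalabanUV.Beta.GAN24.CombContactKernelCells

/-!
# `BalabanUV.Beta.GAN24.CombBornLambdaContactLineage` — binder row G-an2-4 ∕ (CONV-C), TRANSFER-III, the (III′) S-slot (b) of the END, born-Λ contact letter `hCg` (road-P2 M.104's
# 3rd hypothesis), LEG HALF, PART 1: **ONE CONJUGATED Λ LINEAGE AT `d = 3` — THE UNIT COUNT** — the twin of leaf-02 g49's PART 4 `BornLambdaContactLineage.abs_weight_mul_contact_le_three`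
# with the CONJUGATED (comb-chart) legs `T′_i = legChain (j ↦ legComp ψ♭_r (respStepBmSeq ρ_l Lc j)) i n`, the conjugated bond gauge functions `λ′ = Ψ + PsiFace − bmGauge`
# (road-P2 M.59 `CombContactKernelCells.combLegChain_sub_respStep`: `T′ − B = dz λ′`) read as MY g89 `(n+2)`-staircase (`CombContactGaugeStaircase.combGauge_eq_staircase ∕
# abs_combGaugePiece_le`, letter `α₁ = (8Lc + F·(1+8Lc(e^{κ₁}+1)))·C₁·(Lc^{5(n+1)})⁻¹`) MERGED to depth `n+1` (the top face piece folded into scale `n`: `blk Lc ∘ blk (Lc^n) = blk (Lc^{n+1})`,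
# letter `α₁·(1+Lc)`), and the TABLE at an1's (0.4)-symmetrised constraint Hessian `SLam Lc c (symHessFFAt ρ_t Lc)` through MY PART 8 `SymContactLambdaEntryBound.abs_contact_entry_le`
# (three independent in-block roots: corrector `r`, dressing `rl`, table `rt`)
# (G-an2-4 CRUX TEAM (2), leaf prover `b2b-balaban-gan24-formalise-leaf-01`, gen 90)

WHAT IS PROVED (`d = 3`, `2 ≤ Lc`; letters as hypotheses with EXPLICIT constants: (N1) `C₁, κ₁`, conjugated envelope `K_E, κ_E`, coefficient decay `C_c, δ_c`, bracket `T_b` at rate `δ_K`,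
face letter `F ≥ faceWtSum r Lc`; common rate `κ = min δ_K κ₁`; [folklore] bookkeeping + elementary power algebra):
* §1 `staircase_merge_top` (a depth-`n+2` staircase is a depth-`n+1` staircase), `polyA_le` (the cell polynomial at `α_g = A·C₁·X⁻¹`, `K_B = C₁·X⁻¹`:
  `2K_B(4α_g + 2α_g·Lc·n) + (8α_g² + 12α_g²·Lc·n) ≤ C₁²·(X⁻¹)²·((n+1)·(8A + 8A² + 4A·Lc + 12A²·Lc))`).
* §2 **`abs_weight_mul_comb_contact_le_three`**: for ALL `κ′ u′ x z a b`,
  `|(cE·Lc^8)^{n+1}·(push₃ T′_i T′_i T′_i (SLam Lc c symH_ρt) κ′u′ x z a b − push₃ B_i B_i B_i (SLam Lc c symH_ρt) κ′u′ x z a b)| ≤ C_fin·((n+1)·(Lc⁻¹)^{n+1})·e^{−(κ∕48)(|x−u′|₁ + |z−u′|₁)}`,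
  `C_fin = Lc^3·((2·(4!·Lc^4))⁻¹·(4·T_b·(e^{8κ})²·Cnt_sym)·(C₁²·P(A,Lc))·Zl 4 (κ∕16))`, `A = (1+Lc)·(8Lc + F·(1+8Lc(e^{κ₁}+1)))`, `Cnt_sym = (2Lc)^4·(4·(4!·(Lc^4·ell 4 Lc)))` — the
  `LocStencil` letter `C·(k−i)^1·θ^{k−i}`, `θ = Lc⁻¹`, of M.104's `hCg` for this lineage, constants uniform in `(r, rl, rt, i, n)` once the letters are.
NOT HERE: the letters (`CombBornLambdaContactBound`).

NOT IN PRINT; OUR BOOKKEEPING ([folklore]; 0 `def`, 0 cited fact, 0 `def … : Prop`, 0 sorry).  HONEST FRAMING (cell contract, verbatim): «discharging `BetaPertH` makes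
Bałaban's UV stability UNCONDITIONAL — a real constructive-QFT result; it is NOT the continuum limit and NOT the Clay problem.»  HONEST DEPENDENCY (verbatim): «continuum YM
on T⁴ ⇐ BetaPertH ∧ nine spine estimates (0/9 proved); BetaPertH ⇐ (D1) ∧ (D4) ∧ CAP+tail; G-an2-4 gates asym, D1 and NE2/3/4.»  Discharges NO letter of M.104 by itself;
NEVER «G-an2-4 closed» as (CONV-C); NOT D1, NOT `BetaPertH`, NOT continuum, NOT Clay.  2026-08-28; no existing file touched.
-/

noncomputable section

open Finset
open scoped BigOperators
open Literature.MathematicalPhysics.QuantumFieldTheory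
open Literature.MathematicalPhysics.QuantumFieldTheory.LatticeForm (quo)
open Literature.MathematicalPhysics.QuantumFieldTheory.Balaban1983to89
open Literature.MathematicalPhysics.QuantumFieldTheory.Balaban1983to89.Beta
open B4ContourShift (supNorm supNorm_nonneg)
open B12Sec2to5 (l1 l1_nonneg)
open ExpKernelCalculus (MKer Zl Zl_nonneg)
open AffineAveraging (Form0 Form1 Site box toSite unitVec dz)
open AveragingContours (blk)
open AveragingHessianKernels (ell)
open OneStepResolventKernel (Fib)
open InterLevelTransport (SLam)
open KernelWard (divV)
open KKTFluctuationKernel (delta1)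
open BalabanCompositeJets (respStep)
open Summit.QuantumFields.BalabanUV.Beta.AxialProjectorBlockMean (bmGaugeAt)
open Summit.QuantumFields.BalabanUV.Beta.SymCorrectorKernel (psiKS)
open Summit.QuantumFields.BalabanUV.Beta.SymCorrectorForms (zetaS)
open Summit.QuantumFields.BalabanUV.Beta.SymCorrectorFace (faceWtSum faceWtSum_nonneg)
open Summit.QuantumFields.BalabanUV.Beta.SymAveragingHessianCounts (symHessFFAt)
open Summit.QuantumFields.BalabanUV.Beta.GAN24.RespStepBmDecompLegs (legAct)
open Summit.QuantumFields.BalabanUV.Beta.GAN24.RespStepBmDecompPsi (Psi)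
open Summit.QuantumFields.BalabanUV.Beta.GAN24.RespStepBmDecompExact (respStepBmSeq blk_blk_pow)
open Summit.QuantumFields.BalabanUV.Beta.GAN24.Push4 (legComp)
open Summit.QuantumFields.BalabanUV.Beta.GAN24.Push4Iter (legChain)
open Summit.QuantumFields.BalabanUV.Beta.GAN24.Push3 (push₃ isFF_push₃)
open Summit.QuantumFields.BalabanUV.Beta.GAN24.Push3LegTelescope (abs_le_of_env' summable_of_env')
open Summit.QuantumFields.BalabanUV.Beta.GAN24.CombLegChainGauge (PsiFace)
open Summit.QuantumFields.BalabanUV.Beta.GAN24.CombContactGaugeStaircase (combGauge_eq_staircase abs_combGaugePiece_le)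
open Summit.QuantumFields.BalabanUV.Beta.GAN24.CombContactKernelCells (combLegChain_sub_respStep)
open Summit.QuantumFields.BalabanUV.Beta.GAN24.ContactLambdaCellBound (exp_env_mono_rate exp_supNorm_add_le_exp_l1)
open Summit.QuantumFields.BalabanUV.Beta.GAN24.SymContactLambdaEntryBound (abs_contact_entry_le)
open Summit.QuantumFields.BalabanUV.Beta.GAN24.BornLambdaContactLineage (units_le)

namespace Summit.QuantumFields.BalabanUV.Beta.GAN24.CombBornLambdaContactLineage

variable {Lc : ℕ} [NeZero Lc]

/-! ## §1 Merging the top piece of a staircase; the cell polynomial at a general gauge letter -/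

omit [NeZero Lc] in
/-- [folklore] **A DEPTH-`(n+2)` STAIRCASE IS A DEPTH-`(n+1)` STAIRCASE**: the top piece (scale `Lc^{n+1}`) is a function of the scale-`Lc^n` block label (`blk Lc ∘ blk (Lc^n) = blk (Lc^{n+1})`),
so it merges into the scale-`n` piece. -/
theorem staircase_merge_top {d : ℕ} (G : ℕ → Site (d + 1) → ℝ) (n : ℕ) (u : Site (d + 1)) :
    ∑ s ∈ Finset.range (n + 1 + 1), G s (blk (Lc ^ s) u)
      = ∑ s ∈ Finset.range (n + 1), (fun (s : ℕ) (y : Site (d + 1)) => G s y + (if s = n then G (n + 1) (blk Lc y) else 0)) s (blk (Lc ^ s) u) := by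
  simp only [Finset.sum_add_distrib]
  rw [Finset.sum_range_succ, Finset.sum_ite_eq' (Finset.range (n + 1)) n, if_pos (Finset.self_mem_range_succ n), blk_blk_pow]

omit [NeZero Lc] in
/-- [folklore] **THE CELL POLYNOMIAL AT A GENERAL GAUGE LETTER** `α_g = A·C₁·X⁻¹`, `K_B = C₁·X⁻¹` (`A, Lc ≥ 0`):
`2K_B(4α_g + 2α_g·Lc·n) + (8α_g² + 2·(6α_g²)·Lc·n) ≤ C₁²·(X⁻¹)²·((n+1)·(8A + 8A² + 4A·Lc + 12A²·Lc))`. -/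
theorem polyA_le {C₁ X A : ℝ} (hX : 0 < X) (hA : 0 ≤ A) (n : ℕ) :
    2 * (C₁ * X⁻¹) * (4 * (A * C₁ * X⁻¹) + 2 * (A * C₁ * X⁻¹) * Lc * n)
        + (8 * (A * C₁ * X⁻¹) ^ 2 + 2 * (6 * (A * C₁ * X⁻¹) ^ 2) * Lc * n)
      ≤ C₁ ^ 2 * (X⁻¹) ^ 2 * (((n : ℝ) + 1) * (8 * A + 8 * A ^ 2 + 4 * A * Lc + 12 * A ^ 2 * Lc)) := by
  have hL : (0 : ℝ) ≤ (Lc : ℝ) := Nat.cast_nonneg _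
  have hn : (0 : ℝ) ≤ n := Nat.cast_nonneg _
  have hB : 0 ≤ C₁ ^ 2 * (X⁻¹) ^ 2 := by positivity
  have e : 2 * (C₁ * X⁻¹) * (4 * (A * C₁ * X⁻¹) + 2 * (A * C₁ * X⁻¹) * Lc * n)
        + (8 * (A * C₁ * X⁻¹) ^ 2 + 2 * (6 * (A * C₁ * X⁻¹) ^ 2) * Lc * n)
      = C₁ ^ 2 * (X⁻¹) ^ 2 * (8 * A + 8 * A ^ 2 + (4 * A * Lc + 12 * A ^ 2 * Lc) * n) := by ring
  rw [e]
  refine mul_le_mul_of_nonneg_left ?_ hB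
  have h1 : 0 ≤ 8 * A + 8 * A ^ 2 := by positivity
  have h2 : 0 ≤ 4 * A * Lc + 12 * A ^ 2 * Lc := by positivity
  nlinarith [mul_nonneg h1 hn, mul_nonneg h2 hn]

/-! ## §2 The weighted contact entry of one conjugated Λ lineage at the symmetrised table -/

section Lineage

variable {r rl rt : Fin (3 + 1) → ℕ} {i n : ℕ} {cE : ℝ} {C₁ κ₁ KE κE Clam Cc δc Tb δK F : ℝ}
  {c : Fin (3 + 1) → (Fin (3 + 1) → ℤ) → Fin (3 + 1) → (Fin (3 + 1) → ℤ) → ℝ}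

set_option maxHeartbeats 800000 in
/-- NOT IN PRINT; OUR PROOF ATTEMPT of the count for ONE conjugated Λ lineage at the (III′) table, every letter a HYPOTHESIS with explicit constants (leaf-02's PART 4 VERBATIM in
structure).  **THE WEIGHTED CONTACT ENTRY OF ONE CONJUGATED Λ LINEAGE** (`d = 3`, `2 ≤ Lc`, in-block roots `r` (corrector), `rl` (dressing), `rt` (table); birth level `i`, `n+1` levels
up): legs `T′_i = legChain (j ↦ legComp ψ♭_r (respStepBmSeq ρ_l Lc j)) i n` (envelope `K_E, κ_E`) and `B_i = respStep (Lc^i) (Lc^{i+n+1})` ((N1) raw letter `C₁, κ₁`), the conjugated bond gauge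
functions `λ′ = Ψ + PsiFace_r − bmGauge` (sup `C_λ`; MY g89 staircase, face letter `F ≥ faceWtSum r Lc`), a coefficient family `c` under decay `C_c, δ_c`, transversality AT THE SYM TABLE, and the
BRACKET letter `T_b·((Lc^n)^7)⁻¹·e^{−δ_K‖quo (Lc^n) y − u′‖∞}` for `T′_i`; weight `(cE·Lc^8)^{n+1}`, `|cE| ≤ Lc^4`.  THEN, with `κ = min δ_K κ₁`, `A = (1+Lc)·(8Lc + F·(1+8Lc(e^{κ₁}+1)))`,
for ALL `κ′ u′ x z a b`:
`|(cE·Lc^8)^{n+1}·(push₃ T′ T′ T′ (SLam Lc c symH_ρt) κ′u′ x z a b − push₃ B B B (SLam Lc c symH_ρt) κ′u′ x z a b)| ≤ C_fin·((n+1)·(Lc⁻¹)^{n+1})·e^{−(κ∕48)(|x−u′|₁ + |z−u′|₁)}`. -/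
theorem abs_weight_mul_comb_contact_le_three (hLc : 2 ≤ Lc) (hr : r ∈ box (3 + 1) Lc) (hrl : rl ∈ box (3 + 1) Lc) (hrt : rt ∈ box (3 + 1) Lc)
    (hcE : |cE| ≤ (Lc : ℝ) ^ 4)
    (hN1 : ∀ (m k : ℕ) (μ : Fin (3 + 1)) (z : Site (3 + 1)) (l'' : Fin (3 + 1)) (w' : Site (3 + 1)),
      |respStep (d := 3) (Lc ^ m) (Lc ^ (m + k + 1)) μ z l'' w'| ≤
        C₁ * ((Lc : ℝ) ^ (5 * (k + 1)))⁻¹ * Real.exp (-(κ₁ * supNorm (quo (Lc ^ (k + 1)) w' - z))))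
    (hκ₁ : 0 < κ₁) (hC₁ : 0 ≤ C₁) (hF : faceWtSum r Lc ≤ F)
    (hE : ∀ μ z l u, |legChain (fun j => legComp (fun α x κ u => psiKS r Lc u x (Sum.inl κ) (Sum.inl α)) (respStepBmSeq (d := 3) (toSite rl) Lc j)) i n μ z l u|
      ≤ KE * Real.exp (-(κE * supNorm (quo (Lc ^ (n + 1)) u - z))))
    (hκE : 0 < κE)
    (hlam : ∀ μ z u, |(Psi (toSite rl) Lc i n (delta1 μ z) + PsiFace r (toSite rl) Lc i n (delta1 μ z)
        - bmGaugeAt (toSite rl) (respStep (d := 3) (Lc ^ i) (Lc ^ (i + n + 1)) μ z) Lc) u| ≤ Clam)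
    (hc : ∀ μ y l u, |c μ y l u| ≤ Cc * Real.exp (-δc * l1 ((Lc : ℤ) • y - u))) (hδc : 0 < δc) (hCc : 0 ≤ Cc)
    (hdiv : ∀ u, divV (SLam Lc c (fun μ y => symHessFFAt (toSite rt) Lc μ y)) u = 0)
    (hbr : ∀ (κ' : Fin (3 + 1)) (u' : Site (3 + 1)) μ y,
      |∑' u, ∑ l, legChain (fun j => legComp (fun α x κ u => psiKS r Lc u x (Sum.inl κ) (Sum.inl α)) (respStepBmSeq (d := 3) (toSite rl) Lc j)) i n κ' u' l u * c μ y l u|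
      ≤ Tb * ((((Lc : ℝ) ^ n) ^ (2 * 3 + 1))⁻¹) * Real.exp (-(δK * supNorm (quo (Lc ^ n) y - u'))))
    (hδK : 0 < δK) (hTb : 0 ≤ Tb)
    (κ' : Fin (3 + 1)) (u' x z : Site (3 + 1)) (a b : Fib 3) :
    |(cE * (Lc : ℝ) ^ (2 * (3 + 1))) ^ (n + 1) *
        (push₃ (legChain (fun j => legComp (fun α x κ u => psiKS r Lc u x (Sum.inl κ) (Sum.inl α)) (respStepBmSeq (d := 3) (toSite rl) Lc j)) i n)
            (legChain (fun j => legComp (fun α x κ u => psiKS r Lc u x (Sum.inl κ) (Sum.inl α)) (respStepBmSeq (d := 3) (toSite rl) Lc j)) i n)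
            (legChain (fun j => legComp (fun α x κ u => psiKS r Lc u x (Sum.inl κ) (Sum.inl α)) (respStepBmSeq (d := 3) (toSite rl) Lc j)) i n)
            (SLam Lc c (fun μ y => symHessFFAt (toSite rt) Lc μ y)) κ' u' x z a b
          - push₃ (respStep (d := 3) (Lc ^ i) (Lc ^ (i + n + 1))) (respStep (d := 3) (Lc ^ i) (Lc ^ (i + n + 1)))
            (respStep (d := 3) (Lc ^ i) (Lc ^ (i + n + 1))) (SLam Lc c (fun μ y => symHessFFAt (toSite rt) Lc μ y)) κ' u' x z a b)|
      ≤ ((Lc : ℝ) ^ 3 * ((2 * ((((3 + 1).factorial : ℕ) : ℝ) * (Lc : ℝ) ^ (3 + 1)))⁻¹ * (((3 : ℝ) + 1) * Tb * (Real.exp (2 * ((3 : ℝ) + 1) * min δK κ₁) ^ 2 *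
              (((2 * Lc : ℕ) : ℝ) ^ (3 + 1) * (((3 + 1 : ℕ) : ℝ) * ((((3 + 1).factorial : ℕ) : ℝ) * ((Lc : ℝ) ^ (3 + 1) * (ell (3 + 1) Lc : ℝ)))))))
            * (C₁ ^ 2 * (8 * ((1 + (Lc : ℝ)) * (8 * (Lc : ℝ) + F * (1 + 8 * (Lc : ℝ) * (Real.exp κ₁ + 1))))
                + 8 * ((1 + (Lc : ℝ)) * (8 * (Lc : ℝ) + F * (1 + 8 * (Lc : ℝ) * (Real.exp κ₁ + 1)))) ^ 2
                + 4 * ((1 + (Lc : ℝ)) * (8 * (Lc : ℝ) + F * (1 + 8 * (Lc : ℝ) * (Real.exp κ₁ + 1)))) * Lc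
                + 12 * ((1 + (Lc : ℝ)) * (8 * (Lc : ℝ) + F * (1 + 8 * (Lc : ℝ) * (Real.exp κ₁ + 1)))) ^ 2 * Lc))
            * Zl (3 + 1) (min δK κ₁ / (4 * ((3 : ℝ) + 1)))))
          * ((((n : ℝ) + 1)) * ((Lc : ℝ)⁻¹) ^ (n + 1))
          * Real.exp (-(min δK κ₁ / 12 / ((3 : ℝ) + 1)) * (l1 (x - u') + l1 (z - u'))) := by
  have hLc1 : 1 ≤ Lc := le_trans (by norm_num) hLc
  have hL : (0 : ℝ) < (Lc : ℝ) := Nat.cast_pos.2 (Nat.pos_of_ne_zero (NeZero.ne Lc))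
  have hLn1 : 1 ≤ Lc ^ (n + 1) := Nat.one_le_pow _ _ hLc1
  have hF0 : 0 ≤ F := (faceWtSum_nonneg r Lc).trans hF
  set κ : ℝ := min δK κ₁ with hκdef
  have hκ : 0 < κ := lt_min hδK hκ₁
  have hκK : κ ≤ δK := min_le_left _ _
  have hκ1 : κ ≤ κ₁ := min_le_right _ _
  -- the gauge letter `A`
  set A : ℝ := (1 + (Lc : ℝ)) * (8 * (Lc : ℝ) + F * (1 + 8 * (Lc : ℝ) * (Real.exp κ₁ + 1))) with hAdef
  have hA0 : 0 ≤ A := by positivity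
  -- the letters at the common rate `κ`
  set T := legChain (fun j => legComp (fun α x κ u => psiKS r Lc u x (Sum.inl κ) (Sum.inl α)) (respStepBmSeq (d := 3) (toSite rl) Lc j)) i n with hTdef
  set B := respStep (d := 3) (Lc ^ i) (Lc ^ (i + n + 1)) with hBdef
  have hT : ∀ μ z' l u, |T μ z' l u| ≤ KE := abs_le_of_env' hκE.le hE
  have hTs : ∀ μ z' l, Summable fun u => T μ z' l u := summable_of_env' hLn1 hκE hE
  have hB : ∀ μ z' l u, |B μ z' l u| ≤ C₁ * ((Lc : ℝ) ^ (5 * (n + 1)))⁻¹ * Real.exp (-(κ * supNorm (quo (Lc ^ (n + 1)) u - z'))) := by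
    intro μ z' l u
    refine (hN1 i n μ z' l u).trans (mul_le_mul_of_nonneg_left (exp_env_mono_rate hκ1 (supNorm_nonneg _)) (by positivity))
  -- the conjugated bond gauge functions and their MERGED staircase pieces, as local names
  set lam : Fin (3 + 1) → Site (3 + 1) → Site (3 + 1) → ℝ := fun μ z' =>
    Psi (toSite rl) Lc i n (delta1 μ z') + PsiFace r (toSite rl) Lc i n (delta1 μ z')
      - bmGaugeAt (toSite rl) (respStep (d := 3) (Lc ^ i) (Lc ^ (i + n + 1)) μ z') Lc with hlamdef
  set G1 : Fin (3 + 1) → Site (3 + 1) → ℕ → Site (3 + 1) → ℝ := fun μ₀ z₀ s y =>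
    (if s ≤ n then
        (if s = 0 then -bmGaugeAt (toSite rl) (respStep (d := 3) (Lc ^ i) (Lc ^ (i + n + 1)) μ₀ z₀) Lc y
         else -(((Lc : ℝ) ^ ((3 + 1) * s))⁻¹ *
           bmGaugeAt (toSite rl) (legAct (respStep (d := 3) (Lc ^ (i + s)) (Lc ^ (i + n + 1))) (delta1 μ₀ z₀)) Lc y))
      else 0)
    + (if s = 0 then 0
       else ((Lc : ℝ) ^ ((3 + 1) * (s - 1)))⁻¹ * ((((box (3 + 1) Lc).card : ℝ))⁻¹ *
         zetaS (toSite r) Lc (legAct (legChain (respStepBmSeq (d := 3) (toSite rl) Lc) (i + (s - 1)) (n - (s - 1))) (delta1 μ₀ z₀)) y)) with hG1def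
  set Gp : Fin (3 + 1) → Site (3 + 1) → ℕ → Site (3 + 1) → ℝ := fun μ₀ z₀ s y =>
    G1 μ₀ z₀ s y + (if s = n then G1 μ₀ z₀ (n + 1) (blk Lc y) else 0) with hGpdef
  have hTB : T - B = fun μ z' l u => dz (lam μ z') l u := by
    have h := combLegChain_sub_respStep (d := 3) hr hrl i n
    exact h
  have hψ : ∀ (μ₀ : Fin (3 + 1)) (z₀ u : Site (3 + 1)), lam μ₀ z₀ u = ∑ s ∈ Finset.range (n + 1), Gp μ₀ z₀ s (blk (Lc ^ s) u) := by
    intro μ₀ z₀ u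
    have h : lam μ₀ z₀ u = ∑ s ∈ Finset.range (n + 1 + 1), G1 μ₀ z₀ s (blk (Lc ^ s) u) := by
      simp only [hlamdef, hG1def]
      exact combGauge_eq_staircase (Lc := Lc) r (toSite rl) i n μ₀ z₀ u
    rw [h, staircase_merge_top]
  have hG1 : ∀ (μ₀ : Fin (3 + 1)) (z₀ : Site (3 + 1)) (s : ℕ), s ≤ n + 1 → ∀ y : Site (3 + 1),
      |G1 μ₀ z₀ s (blk (Lc ^ s) y)| ≤ (8 * (Lc : ℝ) * C₁ * ((Lc : ℝ) ^ (5 * (n + 1)))⁻¹ + F * ((1 + 8 * (Lc : ℝ) * (Real.exp κ₁ + 1)) * C₁ * ((Lc : ℝ) ^ (5 * (n + 1)))⁻¹)) *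
          (Lc : ℝ) ^ s * Real.exp (-(κ₁ * supNorm (quo (Lc ^ (n + 1)) y - z₀))) := by
    intro μ₀ z₀ s hs y
    have h := abs_combGaugePiece_le (Lc := Lc) hκ₁.le hC₁ hN1 hr hrl hF i n μ₀ z₀ hs y
    simp only [hG1def] at h ⊢
    exact h
  have hG : ∀ (μ₀ : Fin (3 + 1)) (z₀ : Site (3 + 1)) (s : ℕ), s ≤ n → ∀ u : Site (3 + 1),
      |Gp μ₀ z₀ s (blk (Lc ^ s) u)| ≤ (A * C₁ * ((Lc : ℝ) ^ (5 * (n + 1)))⁻¹) * (Lc : ℝ) ^ s * Real.exp (-(κ * supNorm (quo (Lc ^ (n + 1)) u - z₀))) := by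
    intro μ₀ z₀ s hs u
    set E₁ : ℝ := Real.exp (-(κ₁ * supNorm (quo (Lc ^ (n + 1)) u - z₀))) with hE₁
    set α1 : ℝ := 8 * (Lc : ℝ) * C₁ * ((Lc : ℝ) ^ (5 * (n + 1)))⁻¹ + F * ((1 + 8 * (Lc : ℝ) * (Real.exp κ₁ + 1)) * C₁ * ((Lc : ℝ) ^ (5 * (n + 1)))⁻¹) with hα1
    have hα10 : 0 ≤ α1 := by positivity
    have eA : A * C₁ * ((Lc : ℝ) ^ (5 * (n + 1)))⁻¹ = (1 + (Lc : ℝ)) * α1 := by rw [hAdef, hα1]; ring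
    have hmono : E₁ ≤ Real.exp (-(κ * supNorm (quo (Lc ^ (n + 1)) u - z₀))) := exp_env_mono_rate hκ1 (supNorm_nonneg _)
    have h1 : |G1 μ₀ z₀ s (blk (Lc ^ s) u)| ≤ α1 * (Lc : ℝ) ^ s * E₁ := hG1 μ₀ z₀ s (by omega) u
    have h2 : |(if s = n then G1 μ₀ z₀ (n + 1) (blk Lc (blk (Lc ^ s) u)) else 0)| ≤ α1 * (Lc : ℝ) ^ (s + 1) * E₁ := by
      split_ifs with hsn
      · subst hsn
        rw [blk_blk_pow]
        exact hG1 μ₀ z₀ (s + 1) le_rfl u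
      · rw [abs_zero]; positivity
    have hsum : |Gp μ₀ z₀ s (blk (Lc ^ s) u)| ≤ α1 * (Lc : ℝ) ^ s * E₁ + α1 * (Lc : ℝ) ^ (s + 1) * E₁ := by
      simp only [hGpdef]
      exact (abs_add_le _ _).trans (add_le_add h1 h2)
    calc |Gp μ₀ z₀ s (blk (Lc ^ s) u)| ≤ α1 * (Lc : ℝ) ^ s * E₁ + α1 * (Lc : ℝ) ^ (s + 1) * E₁ := hsum
      _ = ((1 + (Lc : ℝ)) * α1) * (Lc : ℝ) ^ s * E₁ := by ring
      _ ≤ ((1 + (Lc : ℝ)) * α1) * (Lc : ℝ) ^ s * Real.exp (-(κ * supNorm (quo (Lc ^ (n + 1)) u - z₀))) :=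
          mul_le_mul_of_nonneg_left hmono (by positivity)
      _ = _ := by rw [eA]
  have hbr' : ∀ (κ' : Fin (3 + 1)) (u' : Site (3 + 1)) μ y, |∑' u, ∑ l, T κ' u' l u * c μ y l u|
      ≤ (Tb * ((((Lc : ℝ) ^ n) ^ (2 * 3 + 1))⁻¹)) * Real.exp (-(κ * supNorm (quo (Lc ^ n) y - u'))) := fun κ' u' μ y =>
    (hbr κ' u' μ y).trans (mul_le_mul_of_nonneg_left (exp_env_mono_rate hκK (supNorm_nonneg _)) (by positivity))
  -- the `inl∕inl` block by MY PART 8 at the sym table; the others vanish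
  have hS := isFF_push₃ (l := T) (r := T) (w := T) (SLam Lc c (fun μ y => symHessFFAt (toSite rt) Lc μ y)) κ' u'
  have hS' := isFF_push₃ (l := B) (r := B) (w := B) (SLam Lc c (fun μ y => symHessFFAt (toSite rt) Lc μ y)) κ' u'
  set PA : ℝ := 8 * A + 8 * A ^ 2 + 4 * A * Lc + 12 * A ^ 2 * Lc with hPAdef
  have hPA0 : 0 ≤ PA := by positivity
  have hRHS0 : 0 ≤ ((Lc : ℝ) ^ 3 * ((2 * ((((3 + 1).factorial : ℕ) : ℝ) * (Lc : ℝ) ^ (3 + 1)))⁻¹ * (((3 : ℝ) + 1) * Tb * (Real.exp (2 * ((3 : ℝ) + 1) * κ) ^ 2 *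
              (((2 * Lc : ℕ) : ℝ) ^ (3 + 1) * (((3 + 1 : ℕ) : ℝ) * ((((3 + 1).factorial : ℕ) : ℝ) * ((Lc : ℝ) ^ (3 + 1) * (ell (3 + 1) Lc : ℝ)))))))
            * (C₁ ^ 2 * PA) * Zl (3 + 1) (κ / (4 * ((3 : ℝ) + 1)))))
          * ((((n : ℝ) + 1)) * ((Lc : ℝ)⁻¹) ^ (n + 1))
          * Real.exp (-(κ / 12 / ((3 : ℝ) + 1)) * (l1 (x - u') + l1 (z - u'))) := by
    have hz : 0 ≤ Zl (3 + 1) (κ / (4 * ((3 : ℝ) + 1))) := Zl_nonneg (by positivity)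
    positivity
  rcases a with α | μa
  · rcases b with β | νb
    · -- the cells
      have hmain := abs_contact_entry_le (d := 3) (Lc := Lc) (rr := rt) (n := n)
        (αg := A * C₁ * ((Lc : ℝ) ^ (5 * (n + 1)))⁻¹) (KB := C₁ * ((Lc : ℝ) ^ (5 * (n + 1)))⁻¹)
        (Tb := Tb * ((((Lc : ℝ) ^ n) ^ (2 * 3 + 1))⁻¹)) (lam := lam) (G := Gp) hLc1 hrt hκ (by positivity) (by positivity)
        (by positivity) hc hδc hCc hdiv hT hTs hB hTB hlam hψ hG hbr' κ' u' x z α β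
      rw [abs_mul]
      have hw0 : 0 ≤ |cE * (Lc : ℝ) ^ (2 * (3 + 1))| ^ (n + 1) := pow_nonneg (abs_nonneg _) _
      rw [abs_pow]
      refine (mul_le_mul_of_nonneg_left hmain hw0).trans ?_
      -- the polynomial, the powers, sup → ℓ¹
      have hX : (0 : ℝ) < (Lc : ℝ) ^ (5 * (n + 1)) := by positivity
      have hP := polyA_le (Lc := Lc) (C₁ := C₁) hX hA0 n
      have hU := units_le (Lc := Lc) hcE n
      have hexp := exp_supNorm_add_le_exp_l1 (d := 3) (c := κ / 12) (by positivity) (x - u') (z - u')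
      have hZ : 0 ≤ Zl (3 + 1) (κ / (4 * ((3 : ℝ) + 1))) := Zl_nonneg (by positivity)
      set E2C : ℝ := Real.exp (2 * ((3 : ℝ) + 1) * κ) ^ 2 *
          (((2 * Lc : ℕ) : ℝ) ^ (3 + 1) * (((3 + 1 : ℕ) : ℝ) * ((((3 + 1).factorial : ℕ) : ℝ) * ((Lc : ℝ) ^ (3 + 1) * (ell (3 + 1) Lc : ℝ))))) with hE2C
      have hE0 : 0 ≤ E2C := by positivity
      set Z : ℝ := Zl (3 + 1) (κ / (4 * ((3 : ℝ) + 1))) with hZdef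
      set S : ℝ := 2 * (C₁ * ((Lc : ℝ) ^ (5 * (n + 1)))⁻¹) * (4 * (A * C₁ * ((Lc : ℝ) ^ (5 * (n + 1)))⁻¹)
            + 2 * (A * C₁ * ((Lc : ℝ) ^ (5 * (n + 1)))⁻¹) * Lc * n)
          + (8 * (A * C₁ * ((Lc : ℝ) ^ (5 * (n + 1)))⁻¹) ^ 2 + 2 * (6 * (A * C₁ * ((Lc : ℝ) ^ (5 * (n + 1)))⁻¹) ^ 2) * Lc * n)
        with hSdef
      set W : ℝ := |cE * (Lc : ℝ) ^ (2 * (3 + 1))| ^ (n + 1) with hWdef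
      set EX : ℝ := Real.exp (-(κ / 12) * (supNorm (x - u') + supNorm (z - u'))) with hEX
      set EX' : ℝ := Real.exp (-(κ / 12 / ((3 : ℝ) + 1)) * (l1 (x - u') + l1 (z - u'))) with hEX'
      have hD0 : 0 ≤ (2 * ((((3 + 1).factorial : ℕ) : ℝ) * (Lc : ℝ) ^ (3 + 1)))⁻¹ := by positivity
      have hS0 : 0 ≤ S := by rw [hSdef]; positivity
      have hW0 : 0 ≤ W := hw0
      have hEX0 : 0 ≤ EX := (Real.exp_pos _).le
      have step1 : W * ((2 * ((((3 + 1).factorial : ℕ) : ℝ) * (Lc : ℝ) ^ (3 + 1)))⁻¹ * ((((3 : ℝ) + 1) * (Tb * ((((Lc : ℝ) ^ n) ^ (2 * 3 + 1))⁻¹)) * E2C) * S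
            * ((((Lc ^ n : ℕ) : ℝ)) ^ (3 + 1) * Z) * EX))
          ≤ W * ((2 * ((((3 + 1).factorial : ℕ) : ℝ) * (Lc : ℝ) ^ (3 + 1)))⁻¹ * ((((3 : ℝ) + 1) * (Tb * ((((Lc : ℝ) ^ n) ^ (2 * 3 + 1))⁻¹)) * E2C)
            * (C₁ ^ 2 * (((Lc : ℝ) ^ (5 * (n + 1)))⁻¹) ^ 2 * (((n : ℝ) + 1) * PA))
            * ((((Lc ^ n : ℕ) : ℝ)) ^ (3 + 1) * Z) * EX')) := by
        refine mul_le_mul_of_nonneg_left (mul_le_mul_of_nonneg_left ?_ hD0) hW0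
        have h1 : 0 ≤ (((3 : ℝ) + 1) * (Tb * ((((Lc : ℝ) ^ n) ^ (2 * 3 + 1))⁻¹)) * E2C) := by positivity
        have h2 : 0 ≤ ((((Lc ^ n : ℕ) : ℝ)) ^ (3 + 1) * Z) := by positivity
        calc (((3 : ℝ) + 1) * (Tb * ((((Lc : ℝ) ^ n) ^ (2 * 3 + 1))⁻¹)) * E2C) * S * ((((Lc ^ n : ℕ) : ℝ)) ^ (3 + 1) * Z) * EX
            ≤ (((3 : ℝ) + 1) * (Tb * ((((Lc : ℝ) ^ n) ^ (2 * 3 + 1))⁻¹)) * E2C)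
              * (C₁ ^ 2 * (((Lc : ℝ) ^ (5 * (n + 1)))⁻¹) ^ 2 * (((n : ℝ) + 1) * PA))
              * ((((Lc ^ n : ℕ) : ℝ)) ^ (3 + 1) * Z) * EX := by
                rw [hPAdef]; gcongr
          _ ≤ _ := mul_le_mul_of_nonneg_left hexp (by positivity)
      have hEX'0 : 0 ≤ EX' := (Real.exp_pos _).le
      refine (le_of_eq ?_).trans (step1.trans ?_)
      · rw [hSdef, hE2C, hZdef, hEX]; ring
      · have h4 : (0 : ℝ) ≤ (3 : ℝ) + 1 := by norm_num
        have hn1 : (0 : ℝ) ≤ (n : ℝ) + 1 := by positivity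
        have hR0 : 0 ≤ (2 * ((((3 + 1).factorial : ℕ) : ℝ) * (Lc : ℝ) ^ (3 + 1)))⁻¹ * ((((3 : ℝ) + 1) * Tb * E2C) * (C₁ ^ 2 * PA) * Z) * (((n : ℝ) + 1)) * EX' :=
          mul_nonneg (mul_nonneg (mul_nonneg hD0 (mul_nonneg (mul_nonneg (mul_nonneg (mul_nonneg h4 hTb) hE0) (mul_nonneg (sq_nonneg C₁) hPA0)) hZ)) hn1) hEX'0
        calc W * ((2 * ((((3 + 1).factorial : ℕ) : ℝ) * (Lc : ℝ) ^ (3 + 1)))⁻¹ * ((((3 : ℝ) + 1) * (Tb * ((((Lc : ℝ) ^ n) ^ (2 * 3 + 1))⁻¹)) * E2C)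
            * (C₁ ^ 2 * (((Lc : ℝ) ^ (5 * (n + 1)))⁻¹) ^ 2 * (((n : ℝ) + 1) * PA))
            * ((((Lc ^ n : ℕ) : ℝ)) ^ (3 + 1) * Z) * EX'))
            = (W * (((((Lc : ℝ) ^ n) ^ (2 * 3 + 1))⁻¹ * ((((Lc : ℝ) ^ (5 * (n + 1)))⁻¹) ^ 2 * (((Lc ^ n : ℕ) : ℝ)) ^ (3 + 1)))))
              * ((2 * ((((3 + 1).factorial : ℕ) : ℝ) * (Lc : ℝ) ^ (3 + 1)))⁻¹ * ((((3 : ℝ) + 1) * Tb * E2C) * (C₁ ^ 2 * PA) * Z) * (((n : ℝ) + 1)) * EX') := by ring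
          _ ≤ ((Lc : ℝ) ^ 3 * ((Lc : ℝ)⁻¹) ^ (n + 1))
              * ((2 * ((((3 + 1).factorial : ℕ) : ℝ) * (Lc : ℝ) ^ (3 + 1)))⁻¹ * ((((3 : ℝ) + 1) * Tb * E2C) * (C₁ ^ 2 * PA) * Z) * (((n : ℝ) + 1)) * EX') := by
              refine mul_le_mul_of_nonneg_right ?_ hR0
              exact hU
          _ = _ := by rw [hE2C, hZdef, hEX']; ring
    · -- `b = inr`: both tables are ff-valued
      rw [hS.2 x z (Sum.inl α) νb, hS'.2 x z (Sum.inl α) νb, sub_self, mul_zero, abs_zero]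
      exact hRHS0
  · rw [hS.1 x z μa b, hS'.1 x z μa b, sub_self, mul_zero, abs_zero]
    exact hRHS0

end Lineage

end Summit.QuantumFields.BalabanUV.Beta.GAN24.CombBornLambdaContactLineage

end
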